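import Literature.NumberTheory.Rogawski1990.LocalTransferCertification
import Literature.NumberTheory.Automorphic.UnitaryGroupTransferAwayOff
import HarnessLib

/-!
# (14.2.1) CERTIFIED off a finite set `S` of finite places, RANK-GENERIC (the `N = 2` inhabitant is the sibling `LocalTransferCertificationOffSRankTwo`)
(Rogawski (1990), §14.1–14.2 pp. 232–233: «we fix an inner isomorphism `ψ : G′ → G`», «if `v ∉ S`, (14.2.1) is obviously satisfied»;
§3.8 p. 30: in rank `2` the anisotropic set `T` of the plane `H` may be non-empty; Gelbart (1975), §10 pp. 154–155)

Topic `NumberTheory/Rogawski1990`; namespace `Literature.NumberTheory.Rogawski1990`.  THEOREMS ONLY (no definition, no named fact, no instance,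
no notation).  Rank-generic sequel of ★ `LocalTransferCertification` (whose heads are wired to `cmDatum L 3 ·`, the quasi-split `Φ₃` and a TOTAL
family `ψ`), written for the `N = 2` edition of the quasi-split comparison letter of the cell `hodgecm-mathlib` (F0P3a SPEC-ed1.19c §7 T1g(2,H);
P5's engine letters E1θhol₂ ∕ E3nec-hol₂ of `Cruxes/HLiu418/Lines/F0_AlbCm`).  In rank `2` NO total family `ψ_v : U(H)(L⁺_v) ≃ₜ* U(Φ₂)(L⁺_v)` exists
once the anisotropic set `T` of `H` is non-empty (★ `isEmpty_forall_cmDatum_local_equiv_antidiagTwo_of_even_finrank`), so the identifications are a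
family DEFINED OFF `S ⊇ T` (★ `UnitaryGroup.exists_psiOff_conj_forall_levelMatching_two`, ★ `GlobalTransferAwayOff`), and (14.2.1) is certified
«obviously» exactly at the places `v ∉ S`; the places `v ∈ S` (the local inner-transfer datum at the anisotropic places) are NOT this file.

The (14.2.1) relation on the `cmDatum` carriers is spelled through the rank-free ★ `IsInnerTransferRel` with the SAME body as the rank-3 abbreviation
★ `IsLocalInnerTransfer` (`3 ↦ N`, `Φ₃ ↦ H₀` an arbitrary receiving form): at `N = 3`, `H₀ = Φ₃` every statement below is `IsLocalInnerTransfer …`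
unfolded, and a rank-2 abbreviation with that body matches by `Iff.rfl` — none is introduced here.

* §1 ONE PLACE, any `N`, any two forms `H` (inner; carries `f′`, `m′`) and `H₀` (receiving): `isInnerTransferRel_cmLocal_iff_forall_eq` ((14.2.1) along a
  class-preserving surjection = equivariance of `Φ^st`), `isInnerTransferRel_cmLocal_transport` (`f′ ↦ f′ ∘ ψ⁻¹` IS a transfer for `ψ_* m′`),
  `isAdmissibleOn_isRegularElt_cmLocal_transport` (`ψ_* m′` admissible on the regular classes), `isInnerTransferRel_cmLocal_of_eq_comp_symm`
  (the equation shape `f = f′ ∘ ψ⁻¹`).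
* §2 ALL PLACES OFF `S`, any `N`: for `ψ : ∀ v, v ∉ S → U(H)(L⁺_v) ≃ₜ* U(H₀)(L⁺_v)` class-preserving both ways and ANY `m′`:
  `forall_isAdmissibleOn_isRegularElt_transport_offS`, `forall_isInnerTransferRel_transport_offS`, the junction
  `forall_isInnerTransferRel_of_localTransferAwayOff` with ★ `LocalTransferAwayOff`; the packaged `exists_measures_isInnerTransferRel_offS` (given
  supplies of admissible families on both sides: total measure families on both sides, the receiving one pinned BY NAME as the transport off `S`).
  The `N = 2` inhabitant over ★ `exists_psiOff_conj_forall_levelMatching_two` and the rank-2 admissible supplies is the sibling file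
  `LocalTransferCertificationOffSRankTwo` (`exists_psiOff_measures_isInnerTransferRel_two`).

HONEST LABEL: HC_CM is proved only modulo the printed citations until rung 0 closes; this file is unconditional and proves no cell binder.

## References
* [Rogawski1990] J. Rogawski, Ann. of Math. Stud. 123 (1990), §14.1–14.2 pp. 232–233 ((14.2.1), `ψ`, `S`, `S₀`), §3.8 p. 30, §4.9 p. 54.
* [Gelbart1975] S. Gelbart, *Automorphic forms on adele groups* (1975), §10 pp. 154–155 (matching orbital integrals class by class off `S`).
-/

set_option autoImplicit false

noncomputable section

open MeasureTheory NumberField IsDedekindDomain Topology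
open scoped Matrix MatrixGroups

namespace Literature.NumberTheory.Rogawski1990

open Literature.NumberTheory.Automorphic

variable (L : Type) [Field L] [NumberField L] [IsCMField L]

/-! ## §1 One place, any rank, any two forms -/

section OnePlace

variable {N : ℕ} (H H₀ : Matrix (Fin N) (Fin N) L) (v : HeightOneSpectrum (𝓞 ↥(maximalRealSubfield L)))

/-- **(14.2.1) at `v` along a class-preserving SURJECTIVE `ψ_v : U(H)(L⁺_v) → U(H₀)(L⁺_v)` is `ψ_v`-equivariance of the local stable orbital
integrals** (any rank, any receiving form `H₀`): the rank-generic body of ★ `isLocalInnerTransfer_iff_forall_eq`. [cite: Rogawski1990, §14.2 (14.2.1) p. 232] -/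
theorem isInnerTransferRel_cmLocal_iff_forall_eq
    {_hγ : ∀ γ : (UnitaryGroup.cmDatum L N H).Local v,
      MeasurableSpace ((UnitaryGroup.cmDatum L N H).Local v ⧸ Subgroup.centralizer ({γ} : Set ((UnitaryGroup.cmDatum L N H).Local v)))}
    {_hγ₀ : ∀ γ : (UnitaryGroup.cmDatum L N H₀).Local v,
      MeasurableSpace ((UnitaryGroup.cmDatum L N H₀).Local v ⧸ Subgroup.centralizer ({γ} : Set ((UnitaryGroup.cmDatum L N H₀).Local v)))}
    (ψ : (UnitaryGroup.cmDatum L N H).Local v → (UnitaryGroup.cmDatum L N H₀).Local v)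
    (hψ : ∀ γ', Corresponds (UnitaryGroup.conjLocal L (IsCMField.complexConj L) v)
      ((UnitaryGroup.adelicForm L N H).map (UnitaryGroup.adeleToLocal L v))
      ((UnitaryGroup.adelicForm L N H₀).map (UnitaryGroup.adeleToLocal L v)) γ' (ψ γ'))
    (hsurj : Function.Surjective ψ)
    (m' : OrbitalMeasureFamily ((UnitaryGroup.cmDatum L N H).Local v))
    (m : OrbitalMeasureFamily ((UnitaryGroup.cmDatum L N H₀).Local v))
    (f' : (UnitaryGroup.cmDatum L N H).Local v → ℂ) (f : (UnitaryGroup.cmDatum L N H₀).Local v → ℂ) :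
    IsInnerTransferRel (A := (UnitaryGroup.cmDatum L N H₀).Local v) (B := (UnitaryGroup.cmDatum L N H).Local v)
        (Corresponds (UnitaryGroup.conjLocal L (IsCMField.complexConj L) v)
          ((UnitaryGroup.adelicForm L N H).map (UnitaryGroup.adeleToLocal L v))
          ((UnitaryGroup.adelicForm L N H₀).map (UnitaryGroup.adeleToLocal L v)))
        (IsStablyConj (UnitaryGroup.conjLocal L (IsCMField.complexConj L) v)
          ((UnitaryGroup.adelicForm L N H).map (UnitaryGroup.adeleToLocal L v)))
        (IsStablyConj (UnitaryGroup.conjLocal L (IsCMField.complexConj L) v)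
          ((UnitaryGroup.adelicForm L N H₀).map (UnitaryGroup.adeleToLocal L v)))
        (fun γ => IsRegularElt (γ.val : GL (Fin N) (UnitaryGroup.LocalRing L v))) m' m f' f ↔
      ∀ γ' : (UnitaryGroup.cmDatum L N H).Local v, IsRegularElt (γ'.val : GL (Fin N) (UnitaryGroup.LocalRing L v)) →
        localStableOrbitalIntegral L N H₀ v m f (ψ γ') = localStableOrbitalIntegral L N H v m' f' γ' :=
  isInnerTransferRel_iff_forall_eq
    (A := (UnitaryGroup.cmDatum L N H₀).Local v) (B := (UnitaryGroup.cmDatum L N H).Local v)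
    (Corresponds (UnitaryGroup.conjLocal L (IsCMField.complexConj L) v)
      ((UnitaryGroup.adelicForm L N H).map (UnitaryGroup.adeleToLocal L v))
      ((UnitaryGroup.adelicForm L N H₀).map (UnitaryGroup.adeleToLocal L v)))
    (IsStablyConj (UnitaryGroup.conjLocal L (IsCMField.complexConj L) v)
      ((UnitaryGroup.adelicForm L N H).map (UnitaryGroup.adeleToLocal L v)))
    (IsStablyConj (UnitaryGroup.conjLocal L (IsCMField.complexConj L) v)
      ((UnitaryGroup.adelicForm L N H₀).map (UnitaryGroup.adeleToLocal L v)))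
    (fun γ => IsRegularElt (γ.val : GL (Fin N) (UnitaryGroup.LocalRing L v)))
    (fun γ' => IsRegularElt (γ'.val : GL (Fin N) (UnitaryGroup.LocalRing L v))) ψ hψ hsurj
    (fun _ _ hc => ⟨isRegularElt_of_isConj hc, isRegularElt_of_isConj hc.symm⟩)
    (fun γ' _ hc _ => ⟨fun h => ((hψ γ').symm.trans hc).trans h, fun h => (hc.symm.trans (hψ γ')).trans h⟩) m' m f' f

variable
  [∀ γ : (UnitaryGroup.cmDatum L N H).Local v,
    MeasurableSpace ((UnitaryGroup.cmDatum L N H).Local v ⧸ Subgroup.centralizer ({γ} : Set ((UnitaryGroup.cmDatum L N H).Local v)))]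
  [∀ γ : (UnitaryGroup.cmDatum L N H).Local v,
    BorelSpace ((UnitaryGroup.cmDatum L N H).Local v ⧸ Subgroup.centralizer ({γ} : Set ((UnitaryGroup.cmDatum L N H).Local v)))]
  [∀ γ : (UnitaryGroup.cmDatum L N H₀).Local v,
    MeasurableSpace ((UnitaryGroup.cmDatum L N H₀).Local v ⧸ Subgroup.centralizer ({γ} : Set ((UnitaryGroup.cmDatum L N H₀).Local v)))]
  [∀ γ : (UnitaryGroup.cmDatum L N H₀).Local v,
    BorelSpace ((UnitaryGroup.cmDatum L N H₀).Local v ⧸ Subgroup.centralizer ({γ} : Set ((UnitaryGroup.cmDatum L N H₀).Local v)))]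

/-- **`f′_v ↦ f_v := f′_v ∘ ψ_v⁻¹` IS a local transfer (14.2.1) at `v` for the transported measures `ψ_* m′`** — any rank `N`, any receiving form
`H₀`, for a class-preserving identification `ψ_v : U(H)(L⁺_v) ≃ₜ* U(H₀)(L⁺_v)` of topological groups and EVERY `f′_v`: [Rogawski1990, §14.2] «if
`v ∉ S`, (14.2.1) is obviously satisfied».  Rank-generic body of ★ `isLocalInnerTransfer_transport`; Borel σ-algebras on the orbit spaces are
hypotheses. [cite: Rogawski1990, §14.2 (14.2.1) p. 232] [cite: Gelbart1975, §10 pp. 154–155] -/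
theorem isInnerTransferRel_cmLocal_transport
    (ψ : (UnitaryGroup.cmDatum L N H).Local v ≃ₜ* (UnitaryGroup.cmDatum L N H₀).Local v)
    (hcl : ∀ γ', Corresponds (UnitaryGroup.conjLocal L (IsCMField.complexConj L) v)
      ((UnitaryGroup.adelicForm L N H).map (UnitaryGroup.adeleToLocal L v))
      ((UnitaryGroup.adelicForm L N H₀).map (UnitaryGroup.adeleToLocal L v)) γ' (ψ γ'))
    (m' : OrbitalMeasureFamily ((UnitaryGroup.cmDatum L N H).Local v)) (f' : (UnitaryGroup.cmDatum L N H).Local v → ℂ) :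
    IsInnerTransferRel (A := (UnitaryGroup.cmDatum L N H₀).Local v) (B := (UnitaryGroup.cmDatum L N H).Local v)
      (Corresponds (UnitaryGroup.conjLocal L (IsCMField.complexConj L) v)
        ((UnitaryGroup.adelicForm L N H).map (UnitaryGroup.adeleToLocal L v))
        ((UnitaryGroup.adelicForm L N H₀).map (UnitaryGroup.adeleToLocal L v)))
      (IsStablyConj (UnitaryGroup.conjLocal L (IsCMField.complexConj L) v)
        ((UnitaryGroup.adelicForm L N H).map (UnitaryGroup.adeleToLocal L v)))
      (IsStablyConj (UnitaryGroup.conjLocal L (IsCMField.complexConj L) v)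
        ((UnitaryGroup.adelicForm L N H₀).map (UnitaryGroup.adeleToLocal L v)))
      (fun γ => IsRegularElt (γ.val : GL (Fin N) (UnitaryGroup.LocalRing L v)))
      m' (m'.transport ψ.toMulEquiv ψ.continuous ψ.symm.continuous) f' (f' ∘ ψ.symm) := by
  refine (isInnerTransferRel_cmLocal_iff_forall_eq L H H₀ v ψ hcl ψ.surjective m' _ f' _).2 fun γ' _ => ?_
  -- `Φ^st(ψ γ′, f′ ∘ ψ⁻¹; ψ_* m′) = Φ^st(γ′, (f′ ∘ ψ⁻¹) ∘ ψ; m′)` by ★ `stableOrbitalIntegralRel_transport`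
  have h := stableOrbitalIntegralRel_transport
    (A := (UnitaryGroup.cmDatum L N H₀).Local v) (B := (UnitaryGroup.cmDatum L N H).Local v)
    ψ.toMulEquiv ψ.continuous ψ.symm.continuous
    (IsStablyConj (UnitaryGroup.conjLocal L (IsCMField.complexConj L) v)
      ((UnitaryGroup.adelicForm L N H₀).map (UnitaryGroup.adeleToLocal L v)))
    (IsStablyConj (UnitaryGroup.conjLocal L (IsCMField.complexConj L) v)
      ((UnitaryGroup.adelicForm L N H).map (UnitaryGroup.adeleToLocal L v)))
    (fun b b' => ⟨fun hb => ((hcl b).symm.trans hb).trans (hcl b'), fun hb => ((hcl b).trans hb).trans (hcl b').symm⟩)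
    (fun _ y y' hc => by
      have hGL : IsConj y.val y'.val := (UnitaryGroup.«local» L (IsCMField.complexConj L) N H₀ v).subtype.map_isConj hc
      exact ⟨fun h' => h'.trans hGL, fun h' => h'.trans hGL.symm⟩)
    (fun _ y y' hc => by
      have hGL : IsConj y.val y'.val := (UnitaryGroup.«local» L (IsCMField.complexConj L) N H v).subtype.map_isConj hc
      exact ⟨fun h' => h'.trans hGL, fun h' => h'.trans hGL.symm⟩)
    m' (f' ∘ ψ.symm) γ'
  have hcomp : ((f' ∘ ψ.symm) ∘ (ψ.toMulEquiv : (UnitaryGroup.cmDatum L N H).Local v → (UnitaryGroup.cmDatum L N H₀).Local v)) = f' :=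
    funext fun b => by
      show f' (ψ.symm (ψ b)) = f' b
      rw [ContinuousMulEquiv.symm_apply_apply]
  rw [hcomp] at h
  exact h

/-- **`ψ_* m′` is admissible on the REGULAR classes of `U(H₀)(L⁺_v)`** when `m′` is admissible on the regular classes of `U(H)(L⁺_v)` and
`ψ_v⁻¹ γ ↔ γ` for every `γ` (any rank; ★ `IsAdmissibleOn.transport`, regularity being a class function ★ `isRegularElt_iff_of_isConj_local`).
Rank-generic body of ★ `isAdmissibleOn_isRegularElt_transport`. [cite: Rogawski1990, §14.2 (14.2.1) p. 232] [cite: Gelbart1975, §10 pp. 154–155] -/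
theorem isAdmissibleOn_isRegularElt_cmLocal_transport
    (ψ : (UnitaryGroup.cmDatum L N H).Local v ≃ₜ* (UnitaryGroup.cmDatum L N H₀).Local v)
    (hcl' : ∀ γ, Corresponds (UnitaryGroup.conjLocal L (IsCMField.complexConj L) v)
      ((UnitaryGroup.adelicForm L N H).map (UnitaryGroup.adeleToLocal L v))
      ((UnitaryGroup.adelicForm L N H₀).map (UnitaryGroup.adeleToLocal L v)) (ψ.symm γ) γ)
    {m' : OrbitalMeasureFamily ((UnitaryGroup.cmDatum L N H).Local v)}
    (hm' : m'.IsAdmissibleOn fun γ => IsRegularElt (γ.val : GL (Fin N) (UnitaryGroup.LocalRing L v))) :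
    (m'.transport ψ.toMulEquiv ψ.continuous ψ.symm.continuous).IsAdmissibleOn
      fun γ => IsRegularElt (γ.val : GL (Fin N) (UnitaryGroup.LocalRing L v)) :=
  hm'.transport ψ.toMulEquiv ψ.continuous ψ.symm.continuous (fun _ _ h => isRegularElt_iff_of_isConj_local L H v h)
    fun γ hγ => isRegularElt_of_isConj (hcl' γ).symm hγ

/-- **(14.2.1) at `v` for `f_v = f′_v ∘ ψ_v⁻¹` given as an EQUATION** (the token shape of ★ `LocalTransferAwayOff`:
`T′.loc v = T.loc v ∘ (ψ v hv).symm`), any rank. [cite: Rogawski1990, §14.2 (14.2.1) p. 232] -/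
theorem isInnerTransferRel_cmLocal_of_eq_comp_symm
    (ψ : (UnitaryGroup.cmDatum L N H).Local v ≃ₜ* (UnitaryGroup.cmDatum L N H₀).Local v)
    (hcl : ∀ γ', Corresponds (UnitaryGroup.conjLocal L (IsCMField.complexConj L) v)
      ((UnitaryGroup.adelicForm L N H).map (UnitaryGroup.adeleToLocal L v))
      ((UnitaryGroup.adelicForm L N H₀).map (UnitaryGroup.adeleToLocal L v)) γ' (ψ γ'))
    (m' : OrbitalMeasureFamily ((UnitaryGroup.cmDatum L N H).Local v)) {f' : (UnitaryGroup.cmDatum L N H).Local v → ℂ}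
    {f : (UnitaryGroup.cmDatum L N H₀).Local v → ℂ} (hf : f = f' ∘ ψ.symm) :
    IsInnerTransferRel (A := (UnitaryGroup.cmDatum L N H₀).Local v) (B := (UnitaryGroup.cmDatum L N H).Local v)
      (Corresponds (UnitaryGroup.conjLocal L (IsCMField.complexConj L) v)
        ((UnitaryGroup.adelicForm L N H).map (UnitaryGroup.adeleToLocal L v))
        ((UnitaryGroup.adelicForm L N H₀).map (UnitaryGroup.adeleToLocal L v)))
      (IsStablyConj (UnitaryGroup.conjLocal L (IsCMField.complexConj L) v)
        ((UnitaryGroup.adelicForm L N H).map (UnitaryGroup.adeleToLocal L v)))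
      (IsStablyConj (UnitaryGroup.conjLocal L (IsCMField.complexConj L) v)
        ((UnitaryGroup.adelicForm L N H₀).map (UnitaryGroup.adeleToLocal L v)))
      (fun γ => IsRegularElt (γ.val : GL (Fin N) (UnitaryGroup.LocalRing L v)))
      m' (m'.transport ψ.toMulEquiv ψ.continuous ψ.symm.continuous) f' f := by
  rw [hf]
  exact isInnerTransferRel_cmLocal_transport L H H₀ v ψ hcl m' f'

end OnePlace

/-! ## §2 All finite places OFF `S`, any rank: the identifications `ψ v hv` (`v ∉ S`) and ANY inner-form family `m′` -/

section OffS

variable {N : ℕ} (H H₀ : Matrix (Fin N) (Fin N) L)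
  [∀ (v : HeightOneSpectrum (𝓞 ↥(maximalRealSubfield L))) (γ : (UnitaryGroup.cmDatum L N H).Local v),
    MeasurableSpace ((UnitaryGroup.cmDatum L N H).Local v ⧸ Subgroup.centralizer ({γ} : Set ((UnitaryGroup.cmDatum L N H).Local v)))]
  [∀ (v : HeightOneSpectrum (𝓞 ↥(maximalRealSubfield L))) (γ : (UnitaryGroup.cmDatum L N H).Local v),
    BorelSpace ((UnitaryGroup.cmDatum L N H).Local v ⧸ Subgroup.centralizer ({γ} : Set ((UnitaryGroup.cmDatum L N H).Local v)))]
  [∀ (v : HeightOneSpectrum (𝓞 ↥(maximalRealSubfield L))) (γ : (UnitaryGroup.cmDatum L N H₀).Local v),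
    MeasurableSpace ((UnitaryGroup.cmDatum L N H₀).Local v ⧸ Subgroup.centralizer ({γ} : Set ((UnitaryGroup.cmDatum L N H₀).Local v)))]
  [∀ (v : HeightOneSpectrum (𝓞 ↥(maximalRealSubfield L))) (γ : (UnitaryGroup.cmDatum L N H₀).Local v),
    BorelSpace ((UnitaryGroup.cmDatum L N H₀).Local v ⧸ Subgroup.centralizer ({γ} : Set ((UnitaryGroup.cmDatum L N H₀).Local v)))]
  (S : Finset (HeightOneSpectrum (𝓞 ↥(maximalRealSubfield L))))
  (ψ : ∀ v : HeightOneSpectrum (𝓞 ↥(maximalRealSubfield L)), v ∉ S →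
    ((UnitaryGroup.cmDatum L N H).Local v ≃ₜ* (UnitaryGroup.cmDatum L N H₀).Local v))

/-- **`(ψ_v)_* m′_v` is admissible on the regular classes at EVERY `v ∉ S`** when each `m′_v` is and `ψ_v⁻¹ γ ↔ γ` off `S`.
[cite: Rogawski1990, §14.2 (14.2.1) p. 232] [cite: Gelbart1975, §10 pp. 154–155] -/
theorem forall_isAdmissibleOn_isRegularElt_transport_offS
    (hcorr' : ∀ v (hv : v ∉ S) (γ : (UnitaryGroup.cmDatum L N H₀).Local v),
      Corresponds (UnitaryGroup.conjLocal L (IsCMField.complexConj L) v)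
        ((UnitaryGroup.adelicForm L N H).map (UnitaryGroup.adeleToLocal L v))
        ((UnitaryGroup.adelicForm L N H₀).map (UnitaryGroup.adeleToLocal L v)) ((ψ v hv).symm γ) γ)
    {m' : ∀ v, OrbitalMeasureFamily ((UnitaryGroup.cmDatum L N H).Local v)}
    (hm' : ∀ v, (m' v).IsAdmissibleOn fun γ => IsRegularElt (γ.val : GL (Fin N) (UnitaryGroup.LocalRing L v))) :
    ∀ v (hv : v ∉ S), ((m' v).transport (ψ v hv).toMulEquiv (ψ v hv).continuous (ψ v hv).symm.continuous).IsAdmissibleOn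
      fun γ => IsRegularElt (γ.val : GL (Fin N) (UnitaryGroup.LocalRing L v)) :=
  fun v hv => isAdmissibleOn_isRegularElt_cmLocal_transport L H H₀ v (ψ v hv) (hcorr' v hv) (hm' v)

/-- **(14.2.1) at EVERY `v ∉ S` for every `ψ`-transported pair of pure tensors** (`T₀.loc v = T.loc v ∘ (ψ v hv)⁻¹` off `S`), for ANY family
`m′` and the transported `(ψ_v)_* m′_v` — «if `v ∉ S`, (14.2.1) is obviously satisfied». [cite: Rogawski1990, §14.2 (14.2.1) p. 232]
[cite: Gelbart1975, §10 pp. 154–155] -/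
theorem forall_isInnerTransferRel_transport_offS
    (hcorr : ∀ v (hv : v ∉ S) (γ' : (UnitaryGroup.cmDatum L N H).Local v),
      Corresponds (UnitaryGroup.conjLocal L (IsCMField.complexConj L) v)
        ((UnitaryGroup.adelicForm L N H).map (UnitaryGroup.adeleToLocal L v))
        ((UnitaryGroup.adelicForm L N H₀).map (UnitaryGroup.adeleToLocal L v)) γ' (ψ v hv γ'))
    (m' : ∀ v, OrbitalMeasureFamily ((UnitaryGroup.cmDatum L N H).Local v))
    (T : UnitaryGroup.PureTensor L N H) (T₀ : UnitaryGroup.PureTensor L N H₀)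
    (hloc : ∀ v (hv : v ∉ S), T₀.loc v = T.loc v ∘ (ψ v hv).symm) :
    ∀ v (hv : v ∉ S),
      IsInnerTransferRel (A := (UnitaryGroup.cmDatum L N H₀).Local v) (B := (UnitaryGroup.cmDatum L N H).Local v)
        (Corresponds (UnitaryGroup.conjLocal L (IsCMField.complexConj L) v)
          ((UnitaryGroup.adelicForm L N H).map (UnitaryGroup.adeleToLocal L v))
          ((UnitaryGroup.adelicForm L N H₀).map (UnitaryGroup.adeleToLocal L v)))
        (IsStablyConj (UnitaryGroup.conjLocal L (IsCMField.complexConj L) v)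
          ((UnitaryGroup.adelicForm L N H).map (UnitaryGroup.adeleToLocal L v)))
        (IsStablyConj (UnitaryGroup.conjLocal L (IsCMField.complexConj L) v)
          ((UnitaryGroup.adelicForm L N H₀).map (UnitaryGroup.adeleToLocal L v)))
        (fun γ => IsRegularElt (γ.val : GL (Fin N) (UnitaryGroup.LocalRing L v)))
        (m' v) ((m' v).transport (ψ v hv).toMulEquiv (ψ v hv).continuous (ψ v hv).symm.continuous) (T.loc v) (T₀.loc v) :=
  fun v hv => isInnerTransferRel_cmLocal_of_eq_comp_symm L H H₀ v (ψ v hv) (hcorr v hv) (m' v) (hloc v hv)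

/-- **Junction with ★ `LocalTransferAwayOff`**: a pair of pure tensors related by `LocalTransferAwayOff S ψ T T₀ S₀bad` satisfies (14.2.1) for the
transported measures at every `v ∉ S`, `v ∉ S₀bad`. [cite: Rogawski1990, §14.2 (14.2.1) p. 232–233] -/
theorem forall_isInnerTransferRel_of_localTransferAwayOff
    (hcorr : ∀ v (hv : v ∉ S) (γ' : (UnitaryGroup.cmDatum L N H).Local v),
      Corresponds (UnitaryGroup.conjLocal L (IsCMField.complexConj L) v)
        ((UnitaryGroup.adelicForm L N H).map (UnitaryGroup.adeleToLocal L v))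
        ((UnitaryGroup.adelicForm L N H₀).map (UnitaryGroup.adeleToLocal L v)) γ' (ψ v hv γ'))
    (m' : ∀ v, OrbitalMeasureFamily ((UnitaryGroup.cmDatum L N H).Local v))
    {T : UnitaryGroup.PureTensor L N H} {T₀ : UnitaryGroup.PureTensor L N H₀}
    {S₀bad : Finset (HeightOneSpectrum (𝓞 ↥(maximalRealSubfield L)))}
    (h : UnitaryGroup.LocalTransferAwayOff L N S ψ T T₀ S₀bad) :
    ∀ v (hv : v ∉ S), v ∉ S₀bad →
      IsInnerTransferRel (A := (UnitaryGroup.cmDatum L N H₀).Local v) (B := (UnitaryGroup.cmDatum L N H).Local v)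
        (Corresponds (UnitaryGroup.conjLocal L (IsCMField.complexConj L) v)
          ((UnitaryGroup.adelicForm L N H).map (UnitaryGroup.adeleToLocal L v))
          ((UnitaryGroup.adelicForm L N H₀).map (UnitaryGroup.adeleToLocal L v)))
        (IsStablyConj (UnitaryGroup.conjLocal L (IsCMField.complexConj L) v)
          ((UnitaryGroup.adelicForm L N H).map (UnitaryGroup.adeleToLocal L v)))
        (IsStablyConj (UnitaryGroup.conjLocal L (IsCMField.complexConj L) v)
          ((UnitaryGroup.adelicForm L N H₀).map (UnitaryGroup.adeleToLocal L v)))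
        (fun γ => IsRegularElt (γ.val : GL (Fin N) (UnitaryGroup.LocalRing L v)))
        (m' v) ((m' v).transport (ψ v hv).toMulEquiv (ψ v hv).continuous (ψ v hv).symm.continuous) (T.loc v) (T₀.loc v) :=
  fun v hv hv₀ => isInnerTransferRel_cmLocal_of_eq_comp_symm L H H₀ v (ψ v hv) (hcorr v hv) (m' v) (h v hv hv₀)

end OffS

/-! ### The packaged certification off `S` with TOTAL measure families on both sides -/

section Packaged

variable {N : ℕ} (H H₀ : Matrix (Fin N) (Fin N) L)
  [∀ (v : HeightOneSpectrum (𝓞 ↥(maximalRealSubfield L))) (γ : (UnitaryGroup.cmDatum L N H).Local v),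
    MeasurableSpace ((UnitaryGroup.cmDatum L N H).Local v ⧸ Subgroup.centralizer ({γ} : Set ((UnitaryGroup.cmDatum L N H).Local v)))]
  [∀ (v : HeightOneSpectrum (𝓞 ↥(maximalRealSubfield L))) (γ : (UnitaryGroup.cmDatum L N H).Local v),
    BorelSpace ((UnitaryGroup.cmDatum L N H).Local v ⧸ Subgroup.centralizer ({γ} : Set ((UnitaryGroup.cmDatum L N H).Local v)))]
  [∀ (v : HeightOneSpectrum (𝓞 ↥(maximalRealSubfield L))) (γ : (UnitaryGroup.cmDatum L N H₀).Local v),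
    MeasurableSpace ((UnitaryGroup.cmDatum L N H₀).Local v ⧸ Subgroup.centralizer ({γ} : Set ((UnitaryGroup.cmDatum L N H₀).Local v)))]
  [∀ (v : HeightOneSpectrum (𝓞 ↥(maximalRealSubfield L))) (γ : (UnitaryGroup.cmDatum L N H₀).Local v),
    BorelSpace ((UnitaryGroup.cmDatum L N H₀).Local v ⧸ Subgroup.centralizer ({γ} : Set ((UnitaryGroup.cmDatum L N H₀).Local v)))]

/-- **(14.2.1) certified OFF `S` with total measure families.**  Given identifications `ψ v hv : U(H)(L⁺_v) ≃ₜ* U(H₀)(L⁺_v)` for `v ∉ S`, class-preserving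
both ways, and supplies of families admissible on the regular classes on BOTH sides at every place (`hm′`, `hm₀`; e.g. ★ `exists_isAdmissibleOn_isRegularElt_of_two_le`,
★ `exists_isAdmissibleOn_isRegularElt_antidiagOne`): there are TOTAL families `m′_v` on `U(H)(L⁺_v)` and `m_v` on `U(H₀)(L⁺_v)`, admissible on the regular
classes at every `v`, with `m_v = (ψ_v)_* m′_v` BY NAME for `v ∉ S` (★ `OrbitalMeasureFamily.transport`; at `v ∈ S` the receiving family is the supplied one),
such that every `ψ`-transported pair of pure tensors (`T₀.loc v = T.loc v ∘ (ψ v hv)⁻¹`, `v ∉ S`) satisfies (14.2.1) at every `v ∉ S`.  Rank-generic, off-`S`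
twin of ★ `exists_measures_isLocalInnerTransfer`. [cite: Rogawski1990, §14.2 (14.2.1) p. 232] [cite: Gelbart1975, §10 pp. 154–155] -/
theorem exists_measures_isInnerTransferRel_offS (S : Finset (HeightOneSpectrum (𝓞 ↥(maximalRealSubfield L))))
    (ψ : ∀ v : HeightOneSpectrum (𝓞 ↥(maximalRealSubfield L)), v ∉ S →
      ((UnitaryGroup.cmDatum L N H).Local v ≃ₜ* (UnitaryGroup.cmDatum L N H₀).Local v))
    (hcorr : ∀ v (hv : v ∉ S) (γ' : (UnitaryGroup.cmDatum L N H).Local v),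
      Corresponds (UnitaryGroup.conjLocal L (IsCMField.complexConj L) v)
        ((UnitaryGroup.adelicForm L N H).map (UnitaryGroup.adeleToLocal L v))
        ((UnitaryGroup.adelicForm L N H₀).map (UnitaryGroup.adeleToLocal L v)) γ' (ψ v hv γ'))
    (hcorr' : ∀ v (hv : v ∉ S) (γ : (UnitaryGroup.cmDatum L N H₀).Local v),
      Corresponds (UnitaryGroup.conjLocal L (IsCMField.complexConj L) v)
        ((UnitaryGroup.adelicForm L N H).map (UnitaryGroup.adeleToLocal L v))
        ((UnitaryGroup.adelicForm L N H₀).map (UnitaryGroup.adeleToLocal L v)) ((ψ v hv).symm γ) γ)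
    (hm' : ∀ v, ∃ m' : OrbitalMeasureFamily ((UnitaryGroup.cmDatum L N H).Local v),
      m'.IsAdmissibleOn fun γ => IsRegularElt (γ.val : GL (Fin N) (UnitaryGroup.LocalRing L v)))
    (hm₀ : ∀ v, ∃ m₀ : OrbitalMeasureFamily ((UnitaryGroup.cmDatum L N H₀).Local v),
      m₀.IsAdmissibleOn fun γ => IsRegularElt (γ.val : GL (Fin N) (UnitaryGroup.LocalRing L v))) :
    ∃ (m' : ∀ v, OrbitalMeasureFamily ((UnitaryGroup.cmDatum L N H).Local v))
      (m : ∀ v, OrbitalMeasureFamily ((UnitaryGroup.cmDatum L N H₀).Local v)),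
      (∀ v, (m' v).IsAdmissibleOn fun γ => IsRegularElt (γ.val : GL (Fin N) (UnitaryGroup.LocalRing L v))) ∧
      (∀ v, (m v).IsAdmissibleOn fun γ => IsRegularElt (γ.val : GL (Fin N) (UnitaryGroup.LocalRing L v))) ∧
      (∀ v (hv : v ∉ S), m v = (m' v).transport (ψ v hv).toMulEquiv (ψ v hv).continuous (ψ v hv).symm.continuous) ∧
      ∀ (T : UnitaryGroup.PureTensor L N H) (T₀ : UnitaryGroup.PureTensor L N H₀),
        (∀ v (hv : v ∉ S), T₀.loc v = T.loc v ∘ (ψ v hv).symm) → ∀ v (hv : v ∉ S),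
          IsInnerTransferRel (A := (UnitaryGroup.cmDatum L N H₀).Local v) (B := (UnitaryGroup.cmDatum L N H).Local v)
            (Corresponds (UnitaryGroup.conjLocal L (IsCMField.complexConj L) v)
              ((UnitaryGroup.adelicForm L N H).map (UnitaryGroup.adeleToLocal L v))
              ((UnitaryGroup.adelicForm L N H₀).map (UnitaryGroup.adeleToLocal L v)))
            (IsStablyConj (UnitaryGroup.conjLocal L (IsCMField.complexConj L) v)
              ((UnitaryGroup.adelicForm L N H).map (UnitaryGroup.adeleToLocal L v)))
            (IsStablyConj (UnitaryGroup.conjLocal L (IsCMField.complexConj L) v)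
              ((UnitaryGroup.adelicForm L N H₀).map (UnitaryGroup.adeleToLocal L v)))
            (fun γ => IsRegularElt (γ.val : GL (Fin N) (UnitaryGroup.LocalRing L v)))
            (m' v) (m v) (T.loc v) (T₀.loc v) := by
  classical
  choose m' hm' using hm'
  choose m₀ hm₀ using hm₀
  refine ⟨m', fun v => if hv : v ∈ S then m₀ v else (m' v).transport (ψ v hv).toMulEquiv (ψ v hv).continuous (ψ v hv).symm.continuous,
    hm', fun v => ?_, fun v hv => ?_, fun T T₀ hloc v hv => ?_⟩
  · by_cases hv : v ∈ S
    · simp only [dif_pos hv]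
      exact hm₀ v
    · simp only [dif_neg hv]
      exact isAdmissibleOn_isRegularElt_cmLocal_transport L H H₀ v (ψ v hv) (hcorr' v hv) (hm' v)
  · simp only [dif_neg hv]
  · simp only [dif_neg hv]
    exact isInnerTransferRel_cmLocal_of_eq_comp_symm L H H₀ v (ψ v hv) (hcorr v hv) (m' v) (hloc v hv)

end Packaged

end Literature.NumberTheory.Rogawski1990

end
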